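/-
Copyright: lit-balaban Phase-2 proof seat p30 (gen 6).  Statement-level skeleton of a published paper; no proof claims beyond what
the kernel checks below.
-/
import Literature.MathematicalPhysics.QuantumFieldTheory.BalabanImbrieJaffe1984to88.BIJ85Rem317Torus
import Literature.MathematicalPhysics.QuantumFieldTheory.BalabanImbrieJaffe1984to88.BIJ85Eq622Torus

/-!
# `BalabanImbrieJaffe1984to88.BIJ85Rem317AnyField` — T. Bałaban, J. Imbrie, A. Jaffe, *Renormalization of the Higgs model: minimizers,
propagators and the stability of mean field theory*, Commun. Math. Phys. **97** (1985) 299–329 [BalabanImbrieJaffe1985]: **Remark 2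
p. 317 for an ARBITRARY unit-lattice gauge field `v`, with the GROUP-valued pull-back (4.5.3)** — *"We can represent an arbitrary v as
v_b = exp(ie_kB_b), (4.5.1) where B_b = (ie_k)^{−1} ln v_b, and the branch of the logarithm was chosen in (2.11)"* (`expField_bondPotential`),
so the background field (4.5.4) built from the group-valued `Q^{s*}_kv` of (4.5.3) (`BIJ85Eq622Torus.qsU1Iter`, = seat p31's `qsstarGIter0`)
IS the Lie-algebra-typed (4.5.4) `exp(ie_kη(Q^{s*}_kB − X))` of row C1.Eq4.5.4 (`background_group_eq_background`), and seat p30's torus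
Remark 2 (`BIJ85Rem317Torus.rem2_torus`, stated for `v = exp(ie_kB)`) holds for EVERY U(1) field `v` on `T^{(k)}` with
`u_k = (Q^{s*}_kv)·exp(−ie_kηX)`, `X = 𝒟_k∂^*Q^{e*}_kf^{(k)}`, `f^{(k)} = (ie_k)^{−1} ln v(∂·)` (`rem2_torus_anyField`), as does its gauge form
(6.3.2) (`rem2_torus_anyField_gauge`)

statement-level skeleton of published theorems with citation tags; proofs where landed; nothing here is a claim about the Yang–Mills mass gap

PDF held: `paper:balaban1985-cmp97-bij-higgs-minimizers` (journal page = PDF page + 298).  Pages read as images: pp. 312–313, 317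
[PDF 14–15, 19] (`HOME/lit-balaban-r15/pages/1985-cmp97-bij-higgs-minimizers-p014,p015,p019-x2.png`).

CITATION HEADER (lean-in-tree rule).  Part of the lit-balaban TYPED SKELETON (HOME `run/shared/lean/pub/lit-balaban/`), Phase-2
seat p30 (gen 6), unit `lit-balaban-p30`; WHAT IS REPRODUCED = rows **C1.Rem@317** (Remark 2, model instance, arbitrary `v`),
**C1.Eq4.5.4** ((4.5.4) group-valued = Lie-algebra-typed) and **C1.Eq4.5.1-4.5.2** ((4.5.1)) of `HOME/SKELETON.md` (reader file
`HOME/lit-balaban-r15/ROWS-C1.md`) AT THE TORUS MODEL OF RECORD (kind «model-instance»).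

THE PRINTED TEXT (verbatim).  p. 312 [PDF 14]: *"We can represent an arbitrary v as v_b = exp(ie_kB_b), (4.5.1) where B_b = (ie_k)^{−1}
ln v_b, and the branch of the logarithm was chosen in (2.11). Then we extend the definition Q^*_s from the Lie algebra to group variables v
by the definition (Q^{s*}_kv)_b = exp((ie_kηQ^{s*}_kB)_b), b ∈ T_η. (4.5.2)"*; p. 313: *"(u_k)_b = (Q^{s*}_kv)_b exp[−ie_kη(𝒟_k∂^*Q^{e*}_k
f^{(k)})_b]. (4.5.4)"*; p. 317 [PDF 19]: *"Remark 2. The gauge field quadratic form ⟨f^{(k)},σ_kf^{(k)}⟩ can now be written entirely as a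
function of the η-lattice gauge field u_k. In fact ⟨f^{(k)},σ_kf^{(k)}⟩ = Σ_{p∈T_η} η^d|f_k(p)|², (5.2.11) where f_k(p) = (ie_kη²)^{−1}
ln u_k(∂p). (5.2.12)"*.

WHAT IS PROVED: `expField_bondPotential` ((4.5.1): `exp(ie·((ie)^{−1} ln v_b)) = v_b` with the branch (2.11), r15's `bondPotential` /
`exp_bondPotential`); `background_group_eq_background` ((4.5.4) with the group-valued `Q^{s*}_kv` = the typed (4.5.4)
`expField (e_kη) (Q^{s*}_kB − X)` for `B = (ie_k)^{−1} ln v`, by the dictionary `BIJ85Eq622Torus.expField_QsstarIter`, `ηL^k = 1`);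
**`rem2_torus_anyField`** (Remark 2 on the tori for every U(1) field `v` on `T^{(k)}`, inside the branch of the logarithm);
`rem2_torus_anyField_gauge` ((6.3.2) for it).  D-0026: theorems only, no `def`, no new named fact.  Unit `lit-balaban-p30`
(literature-prover-lit-balaban-p30-g6-0), 2026-08-21.
-/

open scoped BigOperators RealInnerProductSpace

namespace Literature.MathematicalPhysics.QuantumFieldTheory.BalabanImbrieJaffe1984to88.BIJ85Rem317AnyField

open Literature.MathematicalPhysics.QuantumFieldTheory.Balaban1983to89
open LatticeFieldCalculus BIJ85Sect1Model BIJ85SmallFieldSplit64 BIJ85AxialPropagator411 BIJ85SigmaForm421 BIJ85UnitPropagator433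
  BIJ85Prop521Proof BIJ85Prop521Torus BIJ85Sigma421Torus BIJ85Eq611Torus BIJ85LandauMinimizer442V1 BIJ85Prop511Torus
  BIJ85Prop522Torus BIJ85Eq531Inputs BIJ85Eq625Torus BIJ85Eq454HolonomyBase0 BIJ85Rem317Torus BIJ85Eq622Torus

noncomputable section

variable {P : Params} {j : ℕ}

/-! ## 1. (4.5.1): every U(1) field is `exp(ieB)` with `B = (ie)^{−1} ln v` (branch (2.11)) -/

/-- **(4.5.1)** p. 312 [PDF 14], verbatim: *"We can represent an arbitrary v as v_b = exp(ie_kB_b), (4.5.1) where B_b = (ie_k)^{−1} ln v_b,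
and the branch of the logarithm was chosen in (2.11)."* — `expField e (bondPotential e v) = v` (r15's bond potential (2.12) and
`exp_bondPotential`; `e ≠ 0`). [cite: BalabanImbrieJaffe1985, (4.5.1) p.312] -/
theorem expField_bondPotential (e : ℝ) (he : e ≠ 0) (v : U1Field P j) : expField e (bondPotential e v) = v := by
  funext b
  apply Circle.ext
  rw [expField, Circle.coe_exp]
  exact exp_bondPotential e he v b

/-! ## 2. (4.5.4): the group-valued and the Lie-algebra-typed background fields agree -/

/-- **(4.5.4) with the group-valued pull-back (4.5.3) IS the typed (4.5.4)**: for every U(1) field `v` on `T^{(k)}` and every η-bond field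
`X`, `(Q^{s*}_kv)·exp(−ie_kηX) = exp(ie_kη(Q^{s*}_kB − X))` with `B = (ie_k)^{−1} ln v` ((4.5.1)) — `Q^{s*}_kv = qsU1Iter k v` (p31's (4.5.3)),
`Q^{s*}_kB = BIJ85Eq531Inputs.QsstarIter k B`, the dictionary `BIJ85Eq622Torus.expField_QsstarIter`; `ηL^k = 1`, `k ≤ m + K`, `e ≠ 0`.
[cite: BalabanImbrieJaffe1985, (4.5.4) p.313] -/
theorem background_group_eq_background {k : ℕ} (hk : k ≤ P.m + P.K) {e : ℝ} (he : e ≠ 0) (η : ℝ) (hη : η * (P.L : ℝ) ^ k = 1)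
    (v : U1Field P k) (X : BondSpace P) :
    qsU1Iter k v * expField (e * η) (WithLp.ofLp (-X)) =
      expField (e * η) (fun b => QsstarIter k (bondPotential e v) b - X b) := by
  conv_lhs => rw [← expField_bondPotential e he v]
  rw [← expField_QsstarIter k hk e η hη]
  funext b
  rw [Pi.mul_apply, expField, expField, expField, ← Circle.exp_add]
  congr 1
  rw [WithLp.ofLp_neg, Pi.neg_apply]
  ring

/-! ## 3. Remark 2 for an arbitrary unit-lattice gauge field -/

/-- **REMARK 2 ON THE TORI FOR EVERY UNIT-LATTICE U(1) FIELD `v`** p. 317 [PDF 19]: with `f^{(k)} = (ie_k)^{−1} ln v(∂·)` ((4.2.4)),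
`X = 𝒟_k∂^*Q^{e*}_kf^{(k)}` (`𝒟_k = DkE`, Landau minimizers) and the background field (4.5.4) `u_k = (Q^{s*}_kv)·exp(−ie_kηX)` built from the
GROUP-valued pull-back `Q^{s*}_kv` of (4.5.3) (`qsU1Iter k v`), inside the branch (2.11) of the logarithm: `⟨f^{(k)}, σ_kf^{(k)}⟩ =
Σ_{p∈T_η} η^d((ie_kη²)^{−1} ln u_k(∂p))²` — seat p30's `BIJ85Rem317Torus.rem2_torus` at `B = (ie_k)^{−1} ln v` ((4.5.1)) and
`background_group_eq_background`; `k ≤ m + K`, `2 ≤ d`, `e ≠ 0`, `η ≠ 0`, `ηL^k = 1`, `w > 0`. [cite: BalabanImbrieJaffe1985, (5.2.11)–(5.2.12) p.317] -/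
theorem rem2_torus_anyField (hd : 2 ≤ P.d) {k : ℕ} (hk : k ≤ P.m + P.K) {e : ℝ} (he : e ≠ 0) {η : ℝ} (hη0 : η ≠ 0)
    (hη : η * (P.L : ℝ) ^ k = 1) {w : ℝ} (hw : 0 < w) (v : U1Field P k) :
    let f : UnitPlaqSpace P k := toU P k (plaqField e v)
    let X : BondSpace P := DkE P w η⁻¹ k (LinearMap.adjoint (curlOp (P := P) w η⁻¹) (QesOp (P := P) hd w k f))
    (∀ p : Plaq P 0, |e * η ^ 2 * (QestarIter hd k (plaqField e v) p - curl η⁻¹ (WithLp.ofLp X) p)| < Real.pi) →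
    ⟪f, sigmaTorus (P := P) hd w η⁻¹ k f⟫ =
      ∑ p : Plaq P 0, w * (plaqField (e * η ^ 2) (qsU1Iter k v * expField (e * η) (WithLp.ofLp (-X))) p) ^ 2 := by
  intro f X hsmall
  have hv := expField_bondPotential e he v
  have h := rem2_torus hd hk he hη0 hη hw (bondPotential e v)
  rw [hv] at h
  rw [background_group_eq_background hk he η hη v X]
  exact h hsmall

/-- **(6.3.2) for it**: the same value at `u_k·e^{−iη∂λ}` for every gauge function `λ` (`BIJ85Rem317Torus.eq632_gaugeForm`, `∂ = grad η⁻¹`).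
[cite: BalabanImbrieJaffe1985, (6.3.2) p.320] -/
theorem rem2_torus_anyField_gauge (hd : 2 ≤ P.d) {k : ℕ} (hk : k ≤ P.m + P.K) {e : ℝ} (he : e ≠ 0) {η : ℝ} (hη0 : η ≠ 0)
    (hη : η * (P.L : ℝ) ^ k = 1) {w : ℝ} (hw : 0 < w) (v : U1Field P k) (lam : Balaban1983to89.Site P 0 → ℝ) :
    let f : UnitPlaqSpace P k := toU P k (plaqField e v)
    let X : BondSpace P := DkE P w η⁻¹ k (LinearMap.adjoint (curlOp (P := P) w η⁻¹) (QesOp (P := P) hd w k f))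
    (∀ p : Plaq P 0, |e * η ^ 2 * (QestarIter hd k (plaqField e v) p - curl η⁻¹ (WithLp.ofLp X) p)| < Real.pi) →
    ⟪f, sigmaTorus (P := P) hd w η⁻¹ k f⟫ =
      ∑ p : Plaq P 0, w * (plaqField (e * η ^ 2)
        (translate62 (qsU1Iter k v * expField (e * η) (WithLp.ofLp (-X))) (expField (-η) (grad η⁻¹ lam))) p) ^ 2 := by
  intro f X hsmall
  rw [eq632_gaugeForm (e * η ^ 2) w η η⁻¹ (mul_inv_cancel₀ hη0) lam]
  exact rem2_torus_anyField hd hk he hη0 hη hw v hsmall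

end

end Literature.MathematicalPhysics.QuantumFieldTheory.BalabanImbrieJaffe1984to88.BIJ85Rem317AnyField
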